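import Literature.AnabelianGeometry.EtaleTheta.FrobenioidThetaBaseSection
import Literature.AlgebraicGeometry.Frobenioids.PreFrobenioidEquivalence
import Literature.AnabelianGeometry.EtaleTheta.Discharge.Sec5Thm56OfBiKummerDataAllLeaves
import Literature.AnabelianGeometry.EtaleTheta.Discharge.Sec5ThetaSectionCompatOfKummerClass
import Literature.AnabelianGeometry.EtaleTheta.Discharge.Sec5PsiTransportDataOfBiKummerData

/-!
# [FrdI] Prop. 5.6 for the CONSTRUCTED section `s^trv_N`: a base-Frobenius pair `φ : ℕ_{≥1} → End(A_N)` commuting with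
# `strvOfBiKummerData` (p.330–331 / PDF pp.104–105)

Mochizuki, *The geometry of Frobenioids I*, Kyushu J. Math. **62** (2008), Prop. 5.6 p.105 ("base-Frobenius pairs"), Thm. 5.2
(i)(ii) pp.100–101 [cite: MochizukiFrdI2008, Prop. 5.6 p.105]; Mochizuki, *The étale theta function …*, Publ. RIMS **45** (2009),
§5 p.330–331 (PDF pp.104–105): "the group homomorphism `s^trv_N : Aut_D(A_N^bs) → Aut_C(A_N)` arising from a base-Frobenius pair
of `A_N`" [cite: MochizukiEtTh2009, §5 p.330–331 (PDF pp.104–105)].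

PROOF-ONLY (no definition, no new named fact).  abc-iut cell, layer L2, row K4 «SUBDAG-Thm56 CONSOLIDATION v3» (seat
abc-iut-w5-d034, custodian): the last σ-side binders `(φ, hφ, hc)` of `Sec5Thm56OfBiKummerDataAllLeavesV3Strv` (p435029,
`…_ofModelHyps_of_pin_strv`) — a base-Frobenius pair `φ` of `A_N` COMMUTING with abc-iut-L2-t4's constructed section
`σ := strvOfBiKummerData h R = frobTrivSection h A_N _` — are PRODUCED:

* `ModelFrobenioid.exists_frobeniusPair_zeroAutSection` — at an object `(A_D, 0)` of the model Frobenioid the Frobenius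
  endomorphisms `(n, id, 0, 1)` form a homomorphism `ℕ_{≥1} → End((A_D, 0))` of base-identity endomorphisms of Frobenius type of
  degree `n` commuting with the zero section `g ↦ (1, g, 0, 1)` ([FrdI] Thm. 5.2 (ii) proof, p.101);
* `ModelFrobenioid.exists_frobeniusPair_conjAutSection` — transport of such a pair along `e : Y ≅ X` (conjugation);
* `ModelFrobenioid.exists_frobeniusPair_frobTrivSection` — hence for `frobTrivSection` at every Frobenius-trivial object;
* `ThetaFrobenioid.exists_sectionPair_strvOfBiKummerData` — at the §5 data: `∃ φ, hφ ∧ hc` for `s^trv_N := strvOfBiKummerData h R`,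
  i.e. EXACTLY the binder `hpair` of `…_ofModelHyps_of_pin_of_sectionPair` at the constructed section and the binders `(φ, hφ, hc)`
  of `…_ofModelHyps_of_pin_strv`;
* `ThetaFrobenioid.exists_rigidityFamily_unique_preserved_ofBiKummerData_of_pin_strv_sectionPair` — the Thm. 5.6 ∘ Prop. 5.5
  all-leaves knit (abc-iut-w5-d020 p428546) at the constructed section with θ PRODUCED (abc-iut-w5-d245 p428815), `hKR` from the
  (η₀, ν) pin (abc-iut-w4-d099) and NO σ-side binder left: `σ`, `hσ`, `hdivc`/`hdivp` (divisor invariance), `φ`, `hφ`, `hc` all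
  discharged — the (C2) residual list of plan/L2/SUBDAG-EtTh-Thm56.md v3.2 minus every σ-side entry.
Nothing asserts that the §5 data exist for an actual curve; no side taken on [IUTchIII] Cor. 3.12.
-/

noncomputable section

namespace Literature.AlgebraicGeometry.Frobenioids

namespace ModelFrobenioid

open CategoryTheory Opposite

universe w v u

variable {D : Type u} [Category.{v} D] {Φ B : Dᵒᵖ ⥤ CommMonCat.{w}} {DivB : B ⟶ monoidGp Φ}

/-- **Frobenius endomorphisms of `(A_D, 0)` commute with the zero section** ([FrdI] Thm. 5.2 (ii) proof, p.101: the morphisms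
`(n, id, 0, 1)` and `(1, g, 0, 1)`): for an object `X` with class `0` there is a homomorphism `φ : ℕ_{≥1} → End_C(X)`,
`φ(n) = (n, id, 0, 1)`, of base-identity endomorphisms of Frobenius type with `deg_Fr(φ(n)) = n`, commuting with every
`zeroAutSection X _ g`.  [cite: MochizukiFrdI2008, Thm. 5.2 p.101] -/
theorem exists_frobeniusPair_zeroAutSection (hBg : Objectwise (fun M _ => IsGroupLike M) B)
    (X : ModelFrobenioid Φ B DivB) (hX : X.cls = 1) :
    ∃ φ : ℕ+ →* End X,
      (∀ n : ℕ+, PreFrobenioid.degFr (toElem Φ B DivB) (End.asHom (φ n)) = n ∧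
        PreFrobenioid.IsBaseIdentity (toElem Φ B DivB) (End.asHom (φ n)) ∧
        PreFrobenioid.IsFrobeniusType (toElem Φ B DivB) (End.asHom (φ n))) ∧
      ∀ (n : ℕ+) (g : Aut X.base), (zeroAutSection X hX g).hom ≫ End.asHom (φ n) = End.asHom (φ n) ≫ (zeroAutSection X hX g).hom := by
  have hrel : ∀ n : ℕ+, X.cls ^ (n : ℕ) * Algebra.GrothendieckGroup.of (1 : Φ.obj (op X.base)) =
      pullGp Φ (𝟙 X.base) X.cls * divB Φ B DivB (op X.base) 1 := fun n => by
    rw [hX]; simp only [one_pow, map_one, mul_one]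
  let fr : ℕ+ → (X ⟶ X) := fun n => mkHom X X n (𝟙 _) 1 1 (hrel n)
  refine ⟨{ toFun := fun n => End.of (fr n), map_one' := ?_, map_mul' := ?_ }, fun n => ⟨rfl, rfl, ?_⟩, fun n g => ?_⟩
  · exact hom_ext rfl rfl rfl rfl
  · intro m n
    show fr (m * n) = fr n ≫ fr m
    refine hom_ext rfl ?_ ?_ ?_
    · show 𝟙 X.base = 𝟙 X.base ≫ 𝟙 X.base
      rw [Category.id_comp]
    · show (1 : Φ.obj (op X.base)) = pull Φ (𝟙 X.base) 1 * (1 : Φ.obj (op X.base)) ^ ((m : ℕ+) : ℕ)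
      rw [map_one, one_pow, mul_one]
    · show (1 : B.obj (op X.base)) = pull B (𝟙 X.base) 1 * (1 : B.obj (op X.base)) ^ ((m : ℕ+) : ℕ)
      rw [map_one, one_pow, mul_one]
  · exact ⟨⟨isCoAngular hBg _, rfl⟩, show IsIso (𝟙 X.base) from inferInstance⟩
  · show (zeroAutSection X hX g).hom ≫ fr n = fr n ≫ (zeroAutSection X hX g).hom
    refine hom_ext ?_ ?_ ?_ ?_
    · show n * (1 : ℕ+) = 1 * n
      rw [mul_one, one_mul]
    · show g.hom ≫ 𝟙 X.base = 𝟙 X.base ≫ g.hom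
      rw [Category.comp_id, Category.id_comp]
    · show pull Φ g.hom 1 * (1 : Φ.obj (op X.base)) ^ ((n : ℕ+) : ℕ) =
        pull Φ (𝟙 X.base) 1 * (1 : Φ.obj (op X.base)) ^ ((1 : ℕ+) : ℕ)
      rw [map_one, map_one, one_pow, one_pow]
    · show pull B g.hom 1 * (1 : B.obj (op X.base)) ^ ((n : ℕ+) : ℕ) =
        pull B (𝟙 X.base) 1 * (1 : B.obj (op X.base)) ^ ((1 : ℕ+) : ℕ)
      rw [map_one, map_one, one_pow, one_pow]

/-- **Transport of a base-Frobenius pair along an isomorphism** ([FrdI] Prop. 5.6: base-Frobenius pairs are determined up to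
conjugation): if `σ₀ : Aut_D(X^bs) → Aut_C(X)` admits a commuting Frobenius homomorphism `φ₀`, then so does
`conjAutSection e σ₀` for `e : Y ≅ X`, namely `n ↦ e ∘ φ₀(n) ∘ e⁻¹`.  [cite: MochizukiFrdI2008, Prop. 5.6 p.105] -/
theorem exists_frobeniusPair_conjAutSection (hP : IsPreFrobenioid Φ (toElem Φ B DivB)) {X Y : ModelFrobenioid Φ B DivB}
    (e : Y ≅ X) (σ₀ : Aut X.base →* Aut X)
    (h₀ : ∃ φ₀ : ℕ+ →* End X,
      (∀ n : ℕ+, PreFrobenioid.degFr (toElem Φ B DivB) (End.asHom (φ₀ n)) = n ∧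
        PreFrobenioid.IsBaseIdentity (toElem Φ B DivB) (End.asHom (φ₀ n)) ∧
        PreFrobenioid.IsFrobeniusType (toElem Φ B DivB) (End.asHom (φ₀ n))) ∧
      ∀ (n : ℕ+) (g : Aut X.base), (σ₀ g).hom ≫ End.asHom (φ₀ n) = End.asHom (φ₀ n) ≫ (σ₀ g).hom) :
    ∃ φ : ℕ+ →* End Y,
      (∀ n : ℕ+, PreFrobenioid.degFr (toElem Φ B DivB) (End.asHom (φ n)) = n ∧
        PreFrobenioid.IsBaseIdentity (toElem Φ B DivB) (End.asHom (φ n)) ∧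
        PreFrobenioid.IsFrobeniusType (toElem Φ B DivB) (End.asHom (φ n))) ∧
      ∀ (n : ℕ+) (g : Aut Y.base),
        (conjAutSection e σ₀ g).hom ≫ End.asHom (φ n) = End.asHom (φ n) ≫ (conjAutSection e σ₀ g).hom := by
  obtain ⟨φ₀, hφ₀, hc₀⟩ := h₀
  refine ⟨{ toFun := fun n => End.of (e.hom ≫ End.asHom (φ₀ n) ≫ e.inv), map_one' := ?_, map_mul' := ?_ },
    fun n => ⟨?_, ?_, ?_⟩, fun n g => ?_⟩
  · show e.hom ≫ End.asHom (φ₀ 1) ≫ e.inv = 𝟙 Y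
    rw [map_one]
    show e.hom ≫ 𝟙 X ≫ e.inv = 𝟙 Y
    rw [Category.id_comp, Iso.hom_inv_id]
  · intro m n
    show e.hom ≫ End.asHom (φ₀ (m * n)) ≫ e.inv =
      (e.hom ≫ End.asHom (φ₀ n) ≫ e.inv) ≫ (e.hom ≫ End.asHom (φ₀ m) ≫ e.inv)
    rw [map_mul]
    show e.hom ≫ (End.asHom (φ₀ n) ≫ End.asHom (φ₀ m)) ≫ e.inv = _
    simp only [Category.assoc, Iso.inv_hom_id_assoc]
  · show PreFrobenioid.degFr (toElem Φ B DivB) (e.hom ≫ End.asHom (φ₀ n) ≫ e.inv) = n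
    rw [PreFrobenioid.degFr_iso_comp, PreFrobenioid.degFr_comp_iso, (hφ₀ n).1]
  · show baseMap (e.hom ≫ End.asHom (φ₀ n) ≫ e.inv) = 𝟙 _
    have hb : baseMap (End.asHom (φ₀ n)) = 𝟙 _ := (hφ₀ n).2.1
    rw [baseMap_comp, baseMap_comp, hb, Category.id_comp, ← baseMap_comp, Iso.hom_inv_id, baseMap_id]
  · show PreFrobenioid.IsFrobeniusType (toElem Φ B DivB) (e.hom ≫ End.asHom (φ₀ n) ≫ e.inv)
    have h' := ((hφ₀ n).2.2.iso_comp hP e.hom).comp_iso hP e.inv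
    simpa only [Category.assoc] using h'
  · -- `conjAutSection e σ₀ g = e ∘ σ₀(Base(e) g Base(e)⁻¹) ∘ e⁻¹`
    have key := hc₀ n (((baseFunctor Φ B DivB).mapIso e).conjAut g)
    change (e.symm.conjAut (σ₀ (((baseFunctor Φ B DivB).mapIso e).conjAut g))).hom ≫
        (e.hom ≫ End.asHom (φ₀ n) ≫ e.inv) =
      (e.hom ≫ End.asHom (φ₀ n) ≫ e.inv) ≫ (e.symm.conjAut (σ₀ (((baseFunctor Φ B DivB).mapIso e).conjAut g))).hom
    rw [Iso.conjAut_hom, Iso.conj_apply, Iso.symm_inv, Iso.symm_hom]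
    simp only [Category.assoc, Iso.inv_hom_id_assoc]
    rw [reassoc_of% key]

/-- **A base-Frobenius pair for `frobTrivSection`** ([FrdI] Prop. 5.6 at a Frobenius-trivial object of the model Frobenioid):
the section `frobTrivSection h X hX` (abc-iut-L2-t4) extends to a section pair — there is `φ : ℕ_{≥1} → End_C(X)` of base-identity
Frobenius-type endomorphisms of degree `n` commuting with it.  [cite: MochizukiFrdI2008, Prop. 5.6 p.105] -/
theorem exists_frobeniusPair_frobTrivSection (h : Hypotheses Φ B) (X : ModelFrobenioid Φ B DivB)
    (hX : PreFrobenioid.IsFrobeniusTrivial (toElem Φ B DivB) X) :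
    ∃ φ : ℕ+ →* End X,
      (∀ n : ℕ+, PreFrobenioid.degFr (toElem Φ B DivB) (End.asHom (φ n)) = n ∧
        PreFrobenioid.IsBaseIdentity (toElem Φ B DivB) (End.asHom (φ n)) ∧
        PreFrobenioid.IsFrobeniusType (toElem Φ B DivB) (End.asHom (φ n))) ∧
      ∀ (n : ℕ+) (g : Aut X.base),
        (frobTrivSection h X hX g).hom ≫ End.asHom (φ n) = End.asHom (φ n) ≫ (frobTrivSection h X hX g).hom :=
  exists_frobeniusPair_conjAutSection
    (isPreFrobenioid (DivB := DivB) h.isMonoidOn h.isDivisorial h.isMonoidOn_rat h.isGroupLike_rat h.isGraphConnected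
      h.isTotallyEpimorphic)
    _ _ (exists_frobeniusPair_zeroAutSection h.isGroupLike_rat _ rfl)

end ModelFrobenioid

end Literature.AlgebraicGeometry.Frobenioids

/-! ## At the assembled §5 data: the section pair of `s^trv_N := strvOfBiKummerData h R` -/

namespace Literature.AnabelianGeometry.EtaleTheta

open CategoryTheory Opposite FrobenioidCyclotomicRigidity Literature.AlgebraicGeometry.Frobenioids

universe u₀ v₀ u v w v₁ u₁

namespace ThetaFrobenioid

section StrvPair

variable {K : Type u₀} [Field K] {X : SemiGraphs.TemperedArithmeticGroup.{u₀} K} {D₀ : Type u₀} [Category.{v₀} D₀]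
  {V : FrdIMonoidStub.{w}} {T₀ : RealifiedDivisorMonoids (D₀ := D₀) V} {D : Type u} [Category.{v} D]
  {VD : FrdICatStub.{u, v, w} D} {S : BiKummerSetting X T₀ D VD}
  {pullFrac : ∀ {A A' : S.C} (_ : A' ⟶ A), S.biratUnits A → S.biratUnits A'}
  {lv N : ℕ+} {θ : S.biratUnits S.Aodot} {Bl : S.C}
  {Pl : S.FractionPair θ Bl} {Rl : S.NthRoot θ Pl lv pullFrac}
  (h : ModelFrobenioid.Hypotheses S.tf.divisorMonoid S.tf.ratFnFunctor) (R : S.NthRoot Rl.root Rl.pair N pullFrac)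

include h in
/-- **`s^trv_N` extends to a section pair** (p.330–331 (PDF pp.104–105): `s^trv_N` "arising from a base-Frobenius pair of `A_N`";
[FrdI] Prop. 5.6): for abc-iut-L2-t4's constructed section `strvOfBiKummerData h R` of the Frobenius-trivial `N`-domain `A_N` there
is `φ : ℕ_{≥1} → End_C(A_N)` of base-identity Frobenius-type endomorphisms with `deg_Fr(φ(n)) = n` commuting with `s^trv_N(g)` for
all `g` — the binders `(φ, hφ, hc)` of `exists_rigidityFamily_unique_preserved_ofBiKummerData_ofModelHyps_of_pin_strv` and the
binder `hpair` of `…_of_pin_of_sectionPair` at this section.  [cite: MochizukiEtTh2009, §5 p.330–331 (PDF pp.104–105)] -/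
theorem exists_sectionPair_strvOfBiKummerData :
    ∃ φ : ℕ+ →* End R.AN,
      (∀ n : ℕ+, PreFrobenioid.degFr S.F (End.asHom (φ n)) = n ∧
        PreFrobenioid.IsBaseIdentity S.F (End.asHom (φ n)) ∧ PreFrobenioid.IsFrobeniusType S.F (End.asHom (φ n))) ∧
      ∀ (n : ℕ+) (g : Aut R.AN.base),
        (strvOfBiKummerData h R g).hom ≫ End.asHom (φ n) = End.asHom (φ n) ≫ (strvOfBiKummerData h R g).hom :=
  ModelFrobenioid.exists_frobeniusPair_frobTrivSection (DivB := S.tf.divBNatTrans) h R.AN R.αData.isFrobeniusTrivial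

end StrvPair


/-! ## The Thm. 5.6 ∘ Prop. 5.5 knit at the constructed section with NO σ-side binder left -/

section Data



variable {K : Type u₀} [Field K]
  {X : SemiGraphs.TemperedArithmeticGroup.{u₀} K} {D₀ : Type u₀} [Category.{v₀} D₀]
  {V : FrdIMonoidStub.{w}} {T₀ : RealifiedDivisorMonoids (D₀ := D₀) V} {D : Type u} [Category.{v} D]
  {VD : FrdICatStub.{u, v, w} D} {S : BiKummerSetting X T₀ D VD}
  {pullFrac : ∀ {A A' : S.C} (_ : A' ⟶ A), S.biratUnits A → S.biratUnits A'}
  {lv N : ℕ+} {l' : ℕ} {RD : RigidData.{max v w} N l'} {θ : S.biratUnits S.Aodot} {Bl : S.C}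
  {Pl : S.FractionPair θ Bl} {Rl : S.NthRoot θ Pl lv pullFrac}
  (h : ModelFrobenioid.Hypotheses S.tf.divisorMonoid S.tf.ratFnFunctor)
  (toB : ∀ A : S.C, S.biratUnits A →* S.tf.biratUnitsModel A) (Q : FrobenioidTheta.ThetaSubquotientStub.{w} D)
  (odd_l : Odd (lv : ℕ)) (R : S.NthRoot Rl.root Rl.pair N pullFrac) (ιX : RD.PiX ≃ₜ* X.Pi)
  (hopen : IsOpen ((S.galoisSurj R.AN.base R.αData.isGalois).ker : Set X.Pi))
  (K' : Type w) [Field K'] (constEmb : K'ˣ →* S.tf.biratUnitsModel R.BN)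
  (constEmb_injective : Function.Injective constEmb)
  -- divisor invariance (replaces `hdivc`/`hdivp` for the CONSTRUCTED section `s^trv_N := strvOfBiKummerData h R`)
  (hinvc : ∀ g : Aut R.AN.base, pull S.tf.divisorMonoid g.hom (ModelFrobenioid.div R.pair.num) = ModelFrobenioid.div R.pair.num)
  (hinvp : ∀ y : RD.PiX, y ∈ RD.PiYdd →
    pull S.tf.divisorMonoid (S.galoisSurj R.AN.base R.αData.isGalois (ιX y)).hom (ModelFrobenioid.div R.pair.den) =
      ModelFrobenioid.div R.pair.den)

/-- **[EtTh] Prop. 5.5 ⊕ Thm. 5.6 (i) AT THE GENUINE §5 DATA, σ-side COMPLETELY PRODUCED**: the θ-produced PIN knit at the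
constructed section `s^trv_N := strvOfBiKummerData h R` (`Sec5Thm56OfBiKummerDataAllLeavesV3Strv`, p435029) with its last σ-side
binders `(φ, hφ, hc)` DISCHARGED by `exists_sectionPair_strvOfBiKummerData`.  Residual = (C2) list v3.2 minus every σ-side entry.
[cite: MochizukiEtTh2009, Thm 5.6 p.328 (PDF p.102); §5 p.331 (PDF p.105)] -/
theorem exists_rigidityFamily_unique_preserved_ofBiKummerData_of_pin_strv_sectionPair
    -- Prop 5.5 side (η / ν pin, reachability, stub laws)
    (hB : (ofBiKummerData h toB Q odd_l R ιX hopen (strvOfBiKummerData h R) K' constEmb constEmb_injective (hdivc_of_pull_invariant h.isDivisorial R (strvOfBiKummerData h R) (baseMap_strvOfBiKummerData h R) hinvc) (hdivp_of_pull_invariant h.isDivisorial R ιX (strvOfBiKummerData h R) (baseMap_strvOfBiKummerData h R) hinvp)).IsThetaSaturated (ofBiKummerData h toB Q odd_l R ιX hopen (strvOfBiKummerData h R) K' constEmb constEmb_injective (hdivc_of_pull_invariant h.isDivisorial R (strvOfBiKummerData h R) (baseMap_strvOfBiKummerData h R) hinvc) (hdivp_of_pull_invariant h.isDivisorial R ιX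 (strvOfBiKummerData h R) (baseMap_strvOfBiKummerData h R) hinvp)).BN) (P : ThetaSubquotientProj (ofBiKummerData h toB Q odd_l R ιX hopen (strvOfBiKummerData h R) K' constEmb constEmb_injective (hdivc_of_pull_invariant h.isDivisorial R (strvOfBiKummerData h R) (baseMap_strvOfBiKummerData h R) hinvc) (hdivp_of_pull_invariant h.isDivisorial R ιX (strvOfBiKummerData h R) (baseMap_strvOfBiKummerData h R) hinvp)))
    {η₀ : RD.PiYdd → RD.mu} (hη₀ : η₀ ∈ RD.thetaCocycles)
    (hdies : ∀ k : RD.PiYdd, rhoOfBiKummerData R ιX k = 1 → η₀ k = 1)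
    (e : RD.mu → (ofBiKummerData h toB Q odd_l R ιX hopen (strvOfBiKummerData h R) K' constEmb constEmb_injective (hdivc_of_pull_invariant h.isDivisorial R (strvOfBiKummerData h R) (baseMap_strvOfBiKummerData h R) hinvc) (hdivp_of_pull_invariant h.isDivisorial R ιX (strvOfBiKummerData h R) (baseMap_strvOfBiKummerData h R) hinvp)).lDeltaModN (ofBiKummerData h toB Q odd_l R ιX hopen (strvOfBiKummerData h R) K' constEmb constEmb_injective (hdivc_of_pull_invariant h.isDivisorial R (strvOfBiKummerData h R) (baseMap_strvOfBiKummerData h R) hinvc) (hdivp_of_pull_invariant h.isDivisorial R ιX (strvOfBiKummerData h R) (baseMap_strvOfBiKummerData h R) hinvp)).BN) (he : Function.Surjective e)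
    (hpre : ∀ k : RD.PiYdd, (k : RD.PiX) ∈ RD.lDeltaTheta → rhoOfBiKummerData R ιX k ∈ P.pre _)
    (hP : ∀ (k : RD.PiYdd) (hk : (k : RD.PiX) ∈ RD.lDeltaTheta) (hm : rhoOfBiKummerData R ιX k ∈ P.pre _),
      (QuotientGroup.mk (P.proj _ ⟨rhoOfBiKummerData R ιX k, hm⟩) : (ofBiKummerData h toB Q odd_l R ιX hopen (strvOfBiKummerData h R) K' constEmb constEmb_injective (hdivc_of_pull_invariant h.isDivisorial R (strvOfBiKummerData h R) (baseMap_strvOfBiKummerData h R) hinvc) (hdivp_of_pull_invariant h.isDivisorial R ιX (strvOfBiKummerData h R) (baseMap_strvOfBiKummerData h R) hinvp)).lDeltaModN (ofBiKummerData h toB Q odd_l R ιX hopen (strvOfBiKummerData h R) K' constEmb constEmb_injective (hdivc_of_pull_invariant h.isDivisorial R (strvOfBiKummerData h R) (baseMap_strvOfBiKummerData h R) hinvc) (hdivp_of_pull_invariant h.isDivisorial R ιX (strvOfBiKummerData h R) (baseMap_strvOfBiKummerData h R) hinvp)).BN) = e (RD.thetaMod ⟨k, hk⟩))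
    (hcov' : ∀ g ∈ P.pre ((ofBiKummerData h toB Q odd_l R ιX hopen (strvOfBiKummerData h R) K' constEmb constEmb_injective (hdivc_of_pull_invariant h.isDivisorial R (strvOfBiKummerData h R) (baseMap_strvOfBiKummerData h R) hinvc) (hdivp_of_pull_invariant h.isDivisorial R ιX (strvOfBiKummerData h R) (baseMap_strvOfBiKummerData h R) hinvp)).base.obj (ofBiKummerData h toB Q odd_l R ιX hopen (strvOfBiKummerData h R) K' constEmb constEmb_injective (hdivc_of_pull_invariant h.isDivisorial R (strvOfBiKummerData h R) (baseMap_strvOfBiKummerData h R) hinvc) (hdivp_of_pull_invariant h.isDivisorial R ιX (strvOfBiKummerData h R) (baseMap_strvOfBiKummerData h R) hinvp)).BN), ∃ k : RD.PiYdd, (k : RD.PiX) ∈ RD.lDeltaTheta ∧ rhoOfBiKummerData R ιX k = g)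
    (ν : (ofBiKummerData h toB Q odd_l R ιX hopen (strvOfBiKummerData h R) K' constEmb constEmb_injective (hdivc_of_pull_invariant h.isDivisorial R (strvOfBiKummerData h R) (baseMap_strvOfBiKummerData h R) hinvc) (hdivp_of_pull_invariant h.isDivisorial R ιX (strvOfBiKummerData h R) (baseMap_strvOfBiKummerData h R) hinvp)).lDeltaModN (ofBiKummerData h toB Q odd_l R ιX hopen (strvOfBiKummerData h R) K' constEmb constEmb_injective (hdivc_of_pull_invariant h.isDivisorial R (strvOfBiKummerData h R) (baseMap_strvOfBiKummerData h R) hinvc) (hdivp_of_pull_invariant h.isDivisorial R ιX (strvOfBiKummerData h R) (baseMap_strvOfBiKummerData h R) hinvp)).BN ≃* (ofBiKummerData h toB Q odd_l R ιX hopen (strvOfBiKummerData h R) K' constEmb constEmb_injective (hdivc_of_pull_invariant h.isDivisorial R (strvOfBiKummerData h R) (baseMap_strvOfBiKummerData h R) hinvc) (hdivp_of_pull_invariant h.isDivisorial R ιX (strvOfBiKummerData h R) (baseMap_strvOfBiKummerData h R) hinvp)).muTorsion (ofBiKummerData h toB Q odd_l R ιX hopen (strvOfBiKummerData h R) K' constEmb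 constEmb_injective (hdivc_of_pull_invariant h.isDivisorial R (strvOfBiKummerData h R) (baseMap_strvOfBiKummerData h R) hinvc) (hdivp_of_pull_invariant h.isDivisorial R ιX (strvOfBiKummerData h R) (baseMap_strvOfBiKummerData h R) hinvp)).BN (ofBiKummerData h toB Q odd_l R ιX hopen (strvOfBiKummerData h R) K' constEmb constEmb_injective (hdivc_of_pull_invariant h.isDivisorial R (strvOfBiKummerData h R) (baseMap_strvOfBiKummerData h R) hinvc) (hdivp_of_pull_invariant h.isDivisorial R ιX (strvOfBiKummerData h R) (baseMap_strvOfBiKummerData h R) hinvp)).N)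
    (hKν : ∀ η : (ofBiKummerData h toB Q odd_l R ιX hopen (strvOfBiKummerData h R) K' constEmb constEmb_injective (hdivc_of_pull_invariant h.isDivisorial R (strvOfBiKummerData h R) (baseMap_strvOfBiKummerData h R) hinvc) (hdivp_of_pull_invariant h.isDivisorial R ιX (strvOfBiKummerData h R) (baseMap_strvOfBiKummerData h R) hinvp)).HB → (ofBiKummerData h toB Q odd_l R ιX hopen (strvOfBiKummerData h R) K' constEmb constEmb_injective (hdivc_of_pull_invariant h.isDivisorial R (strvOfBiKummerData h R) (baseMap_strvOfBiKummerData h R) hinvc) (hdivp_of_pull_invariant h.isDivisorial R ιX (strvOfBiKummerData h R) (baseMap_strvOfBiKummerData h R) hinvp)).lDeltaModN (ofBiKummerData h toB Q odd_l R ιX hopen (strvOfBiKummerData h R) K' constEmb constEmb_injective (hdivc_of_pull_invariant h.isDivisorial R (strvOfBiKummerData h R) (baseMap_strvOfBiKummerData h R) hinvc) (hdivp_of_pull_invariant h.isDivisorial R ιX (strvOfBiKummerData h R) (baseMap_strvOfBiKummerData h R) hinvp)).BN,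
      (∀ k : RD.PiYdd, η ⟨rhoOfBiKummerData R ιX k, Subgroup.mem_map_of_mem _ k.2⟩ = e (η₀ k)) →
        FrobenioidThetaBiKummer.ThetaPairKummerClass (ofBiKummerData h toB Q odd_l R ιX hopen (strvOfBiKummerData h R) K' constEmb constEmb_injective (hdivc_of_pull_invariant h.isDivisorial R (strvOfBiKummerData h R) (baseMap_strvOfBiKummerData h R) hinvc) (hdivp_of_pull_invariant h.isDivisorial R ιX (strvOfBiKummerData h R) (baseMap_strvOfBiKummerData h R) hinvp)) η ν)
    (hgeom : P.pre R.BN.base ≤ RD.aug.ker.map (rhoOfBiKummerData R ιX))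
    -- T56-L09b: Prop 3.4 (ii) constants + the origin clause «cnst kills Ker aug» (G-w5d020-2)
    {Dcnst : Type u₁} [Category.{v₁} Dcnst] {cnst : D₀ ⥤ Dcnst} (hP34 : RealifiedDivisorMonoids.Prop34Cnst T₀ cnst)
    (hΔcnst : ∀ δ ∈ RD.aug.ker,
      cnst.map (S.tf.base.map (rhoOfBiKummerData R ιX δ).hom) = 𝟙 (cnst.obj (S.tf.base.obj R.BN.base)))
    (hreach : LinearlyReachableFromBN (ofBiKummerData h toB Q odd_l R ιX hopen (strvOfBiKummerData h R) K' constEmb constEmb_injective (hdivc_of_pull_invariant h.isDivisorial R (strvOfBiKummerData h R) (baseMap_strvOfBiKummerData h R) hinvc) (hdivp_of_pull_invariant h.isDivisorial R ιX (strvOfBiKummerData h R) (baseMap_strvOfBiKummerData h R) hinvp)))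
    (hLc : Thm56Sub.LDeltaMapComp (ofBiKummerData h toB Q odd_l R ιX hopen (strvOfBiKummerData h R) K' constEmb constEmb_injective (hdivc_of_pull_invariant h.isDivisorial R (strvOfBiKummerData h R) (baseMap_strvOfBiKummerData h R) hinvc) (hdivp_of_pull_invariant h.isDivisorial R ιX (strvOfBiKummerData h R) (baseMap_strvOfBiKummerData h R) hinvp))) (hLi : Thm56Sub.LDeltaMapId (ofBiKummerData h toB Q odd_l R ιX hopen (strvOfBiKummerData h R) K' constEmb constEmb_injective (hdivc_of_pull_invariant h.isDivisorial R (strvOfBiKummerData h R) (baseMap_strvOfBiKummerData h R) hinvc) (hdivp_of_pull_invariant h.isDivisorial R ιX (strvOfBiKummerData h R) (baseMap_strvOfBiKummerData h R) hinvp)))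
    -- P55-L06 leaves: (G) as the base law, hproj named, hcup as the pull-root law of abc-iut-L6-t23
    (hGalT : ∀ ⦃A : D⦄, S.IsGaloisObj A → ∀ ⦃T : D⦄ (b b' : A ⟶ T), ∃ g : Aut A, b' = g.hom ≫ b)
    (hproj : ∀ (g g' : Aut ((ofBiKummerData h toB Q odd_l R ιX hopen (strvOfBiKummerData h R) K' constEmb constEmb_injective (hdivc_of_pull_invariant h.isDivisorial R (strvOfBiKummerData h R) (baseMap_strvOfBiKummerData h R) hinvc) (hdivp_of_pull_invariant h.isDivisorial R ιX (strvOfBiKummerData h R) (baseMap_strvOfBiKummerData h R) hinvp)).base.obj (ofBiKummerData h toB Q odd_l R ιX hopen (strvOfBiKummerData h R) K' constEmb constEmb_injective (hdivc_of_pull_invariant h.isDivisorial R (strvOfBiKummerData h R) (baseMap_strvOfBiKummerData h R) hinvc) (hdivp_of_pull_invariant h.isDivisorial R ιX (strvOfBiKummerData h R) (baseMap_strvOfBiKummerData h R) hinvp)).BN)) (hh : g' ∈ P.pre _), ∃ hgh : g * g' * g⁻¹ ∈ P.pre _,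
      (ofBiKummerData h toB Q odd_l R ιX hopen (strvOfBiKummerData h R) K' constEmb constEmb_injective (hdivc_of_pull_invariant h.isDivisorial R (strvOfBiKummerData h R) (baseMap_strvOfBiKummerData h R) hinvc) (hdivp_of_pull_invariant h.isDivisorial R ιX (strvOfBiKummerData h R) (baseMap_strvOfBiKummerData h R) hinvp)).lDeltaMap g.hom (P.proj _ ⟨g', hh⟩) = P.proj _ ⟨g * g' * g⁻¹, hgh⟩)
    -- hKR (G-L6t23-3) by abc-iut-w4-d099's PIN route (p-file Sec5ThetaSectionCompatOfKummerClass): «Prop 5.2 (iii) enters ONCE» —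
    -- the (η₀, ν) pin above + Facts + the cyclotome dictionary m with m ∘ ν ∘ e = id + cyclotomic-character compatibility (F-1306)
    (H : (ofBiKummerData h toB Q odd_l R ιX hopen (strvOfBiKummerData h R) K' constEmb constEmb_injective (hdivc_of_pull_invariant h.isDivisorial R (strvOfBiKummerData h R) (baseMap_strvOfBiKummerData h R) hinvc) (hdivp_of_pull_invariant h.isDivisorial R ιX (strvOfBiKummerData h R) (baseMap_strvOfBiKummerData h R) hinvp)).Facts)
    (m : (ofBiKummerData h toB Q odd_l R ιX hopen (strvOfBiKummerData h R) K' constEmb constEmb_injective (hdivc_of_pull_invariant h.isDivisorial R (strvOfBiKummerData h R) (baseMap_strvOfBiKummerData h R) hinvc) (hdivp_of_pull_invariant h.isDivisorial R ιX (strvOfBiKummerData h R) (baseMap_strvOfBiKummerData h R) hinvp)).muTorsion (ofBiKummerData h toB Q odd_l R ιX hopen (strvOfBiKummerData h R) K' constEmb constEmb_injective (hdivc_of_pull_invariant h.isDivisorial R (strvOfBiKummerData h R) (baseMap_strvOfBiKummerData h R) hinvc) (hdivp_of_pull_invariant h.isDivisorial R ιX (strvOfBiKummerData h R) (baseMap_strvOfBiKummerData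 h R) hinvp)).BN (ofBiKummerData h toB Q odd_l R ιX hopen (strvOfBiKummerData h R) K' constEmb constEmb_injective (hdivc_of_pull_invariant h.isDivisorial R (strvOfBiKummerData h R) (baseMap_strvOfBiKummerData h R) hinvc) (hdivp_of_pull_invariant h.isDivisorial R ιX (strvOfBiKummerData h R) (baseMap_strvOfBiKummerData h R) hinvp)).N ≃* RD.mu)
    (hme : ∀ x : RD.mu, m (ν (e x)) = x)
    (hχX : (ofBiKummerData h toB Q odd_l R ιX hopen (strvOfBiKummerData h R) K' constEmb constEmb_injective (hdivc_of_pull_invariant h.isDivisorial R (strvOfBiKummerData h R) (baseMap_strvOfBiKummerData h R) hinvc) (hdivp_of_pull_invariant h.isDivisorial R ιX (strvOfBiKummerData h R) (baseMap_strvOfBiKummerData h R) hinvp)).CyclotomicCharacterCompatX RD.toThetaEnvData (MulEquiv.refl _) m)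
    (hcovHB : ∀ k : (ofBiKummerData h toB Q odd_l R ιX hopen (strvOfBiKummerData h R) K' constEmb constEmb_injective (hdivc_of_pull_invariant h.isDivisorial R (strvOfBiKummerData h R) (baseMap_strvOfBiKummerData h R) hinvc) (hdivp_of_pull_invariant h.isDivisorial R ιX (strvOfBiKummerData h R) (baseMap_strvOfBiKummerData h R) hinvp)).HB, (k : Aut ((ofBiKummerData h toB Q odd_l R ιX hopen (strvOfBiKummerData h R) K' constEmb constEmb_injective (hdivc_of_pull_invariant h.isDivisorial R (strvOfBiKummerData h R) (baseMap_strvOfBiKummerData h R) hinvc) (hdivp_of_pull_invariant h.isDivisorial R ιX (strvOfBiKummerData h R) (baseMap_strvOfBiKummerData h R) hinvp)).base.obj (ofBiKummerData h toB Q odd_l R ιX hopen (strvOfBiKummerData h R) K' constEmb constEmb_injective (hdivc_of_pull_invariant h.isDivisorial R (strvOfBiKummerData h R) (baseMap_strvOfBiKummerData h R) hinvc) (hdivp_of_pull_invariant h.isDivisorial R ιX (strvOfBiKummerData h R) (baseMap_strvOfBiKummerData h R) hinvp)).BN)) ∈ P.pre _ →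
      ∃ (y : RD.PiX) (_ : y ∈ RD.PiYdd), (ofBiKummerData h toB Q odd_l R ιX hopen (strvOfBiKummerData h R) K' constEmb constEmb_injective (hdivc_of_pull_invariant h.isDivisorial R (strvOfBiKummerData h R) (baseMap_strvOfBiKummerData h R) hinvc) (hdivp_of_pull_invariant h.isDivisorial R ιX (strvOfBiKummerData h R) (baseMap_strvOfBiKummerData h R) hinvp)).ρ y = k ∧ y ∈ RD.lDeltaTheta)
    -- t4's inputs discharging hdiff ([FrdI] Prop 5.6 section law, Π^tp_Ÿ ⊆ H_⊙, Thm 5.2 (ii) dictionary)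
    (hH : ∀ y : RD.PiX, y ∈ RD.PiYdd → ιX y ∈ S.Hodot)
    (hfrac : ∀ {A B : S.C} (s' s'' : A ⟶ B) (h' : S.IsPreStep s') (h'' : S.IsPreStep s'')
      (hb : PreFrobenioid.BaseEquivalent S.F s' s''),
      (toB A (S.fracOf s' s'' h' h'' hb) : S.tf.ratFnFunctor.obj (op A.base)) *
        ModelFrobenioid.unit s'' = ModelFrobenioid.unit s')
    (haut : ∀ {A : S.C} (e : Aut A) (x : S.biratUnits A),
      (toB A (S.biratAut A e x) : S.tf.ratFnFunctor.obj (op A.base)) =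
        pull S.tf.ratFnFunctor (ModelFrobenioid.baseMap e.inv) (toB A x : S.tf.ratFnFunctor.obj (op A.base)))
    -- Thm 5.6 side: Ψ, its base shadow, Δ-transport and μ-pull data (abc-iut-L2-d4)
    (Ψ : S.C ≌ S.C) (Ψbs : D ⥤ D) [Ψbs.Faithful] (eΨ : Ψ.functor ⋙ (ofBiKummerData h toB Q odd_l R ιX hopen (strvOfBiKummerData h R) K' constEmb constEmb_injective (hdivc_of_pull_invariant h.isDivisorial R (strvOfBiKummerData h R) (baseMap_strvOfBiKummerData h R) hinvc) (hdivp_of_pull_invariant h.isDivisorial R ιX (strvOfBiKummerData h R) (baseMap_strvOfBiKummerData h R) hinvp)).base ≅ (ofBiKummerData h toB Q odd_l R ιX hopen (strvOfBiKummerData h R) K' constEmb constEmb_injective (hdivc_of_pull_invariant h.isDivisorial R (strvOfBiKummerData h R) (baseMap_strvOfBiKummerData h R) hinvc) (hdivp_of_pull_invariant h.isDivisorial R ιX (strvOfBiKummerData h R) (baseMap_strvOfBiKummerData h R) hinvp)).base ⋙ Ψbs)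
    (aΨ : ∀ A : S.C, (ofBiKummerData h toB Q odd_l R ιX hopen (strvOfBiKummerData h R) K' constEmb constEmb_injective (hdivc_of_pull_invariant h.isDivisorial R (strvOfBiKummerData h R) (baseMap_strvOfBiKummerData h R) hinvc) (hdivp_of_pull_invariant h.isDivisorial R ιX (strvOfBiKummerData h R) (baseMap_strvOfBiKummerData h R) hinvp)).lDeltaModN A ≃* (ofBiKummerData h toB Q odd_l R ιX hopen (strvOfBiKummerData h R) K' constEmb constEmb_injective (hdivc_of_pull_invariant h.isDivisorial R (strvOfBiKummerData h R) (baseMap_strvOfBiKummerData h R) hinvc) (hdivp_of_pull_invariant h.isDivisorial R ιX (strvOfBiKummerData h R) (baseMap_strvOfBiKummerData h R) hinvp)).lDeltaModN (Ψ.functor.obj A))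
    (hlin : PreFrobenioidData.PreservesMor Ψ.functor (ofBiKummerData h toB Q odd_l R ιX hopen (strvOfBiKummerData h R) K' constEmb constEmb_injective (hdivc_of_pull_invariant h.isDivisorial R (strvOfBiKummerData h R) (baseMap_strvOfBiKummerData h R) hinvc) (hdivp_of_pull_invariant h.isDivisorial R ιX (strvOfBiKummerData h R) (baseMap_strvOfBiKummerData h R) hinvp)).IsLinear (ofBiKummerData h toB Q odd_l R ιX hopen (strvOfBiKummerData h R) K' constEmb constEmb_injective (hdivc_of_pull_invariant h.isDivisorial R (strvOfBiKummerData h R) (baseMap_strvOfBiKummerData h R) hinvc) (hdivp_of_pull_invariant h.isDivisorial R ιX (strvOfBiKummerData h R) (baseMap_strvOfBiKummerData h R) hinvp)).IsLinear)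
    (haΨn : ∀ {A A' : S.C} (φ : A ⟶ A') (x : (ofBiKummerData h toB Q odd_l R ιX hopen (strvOfBiKummerData h R) K' constEmb constEmb_injective (hdivc_of_pull_invariant h.isDivisorial R (strvOfBiKummerData h R) (baseMap_strvOfBiKummerData h R) hinvc) (hdivp_of_pull_invariant h.isDivisorial R ιX (strvOfBiKummerData h R) (baseMap_strvOfBiKummerData h R) hinvp)).lDeltaModN A),
      aΨ A' ((ofBiKummerData h toB Q odd_l R ιX hopen (strvOfBiKummerData h R) K' constEmb constEmb_injective (hdivc_of_pull_invariant h.isDivisorial R (strvOfBiKummerData h R) (baseMap_strvOfBiKummerData h R) hinvc) (hdivp_of_pull_invariant h.isDivisorial R ιX (strvOfBiKummerData h R) (baseMap_strvOfBiKummerData h R) hinvp)).lDeltaModNMap φ x) = (ofBiKummerData h toB Q odd_l R ιX hopen (strvOfBiKummerData h R) K' constEmb constEmb_injective (hdivc_of_pull_invariant h.isDivisorial R (strvOfBiKummerData h R) (baseMap_strvOfBiKummerData h R) hinvc) (hdivp_of_pull_invariant h.isDivisorial R ιX (strvOfBiKummerData h R) (baseMap_strvOfBiKummerData h R) hinvp)).lDeltaModNMap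 (Ψ.functor.map φ) (aΨ A x))
    (hpull : ∀ {A A' : S.C} (φ : A ⟶ A') (u : (ofBiKummerData h toB Q odd_l R ιX hopen (strvOfBiKummerData h R) K' constEmb constEmb_injective (hdivc_of_pull_invariant h.isDivisorial R (strvOfBiKummerData h R) (baseMap_strvOfBiKummerData h R) hinvc) (hdivp_of_pull_invariant h.isDivisorial R ιX (strvOfBiKummerData h R) (baseMap_strvOfBiKummerData h R) hinvp)).muTorsion A' (ofBiKummerData h toB Q odd_l R ιX hopen (strvOfBiKummerData h R) K' constEmb constEmb_injective (hdivc_of_pull_invariant h.isDivisorial R (strvOfBiKummerData h R) (baseMap_strvOfBiKummerData h R) hinvc) (hdivp_of_pull_invariant h.isDivisorial R ιX (strvOfBiKummerData h R) (baseMap_strvOfBiKummerData h R) hinvp)).N)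
      (hu : Ψ.functor.mapAut A' (u : Aut A') ∈ (ofBiKummerData h toB Q odd_l R ιX hopen (strvOfBiKummerData h R) K' constEmb constEmb_injective (hdivc_of_pull_invariant h.isDivisorial R (strvOfBiKummerData h R) (baseMap_strvOfBiKummerData h R) hinvc) (hdivp_of_pull_invariant h.isDivisorial R ιX (strvOfBiKummerData h R) (baseMap_strvOfBiKummerData h R) hinvp)).muTorsion (Ψ.functor.obj A') (ofBiKummerData h toB Q odd_l R ιX hopen (strvOfBiKummerData h R) K' constEmb constEmb_injective (hdivc_of_pull_invariant h.isDivisorial R (strvOfBiKummerData h R) (baseMap_strvOfBiKummerData h R) hinvc) (hdivp_of_pull_invariant h.isDivisorial R ιX (strvOfBiKummerData h R) (baseMap_strvOfBiKummerData h R) hinvp)).N),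
      Ψ.functor.mapAut A ((ofBiKummerData h toB Q odd_l R ιX hopen (strvOfBiKummerData h R) K' constEmb constEmb_injective (hdivc_of_pull_invariant h.isDivisorial R (strvOfBiKummerData h R) (baseMap_strvOfBiKummerData h R) hinvc) (hdivp_of_pull_invariant h.isDivisorial R ιX (strvOfBiKummerData h R) (baseMap_strvOfBiKummerData h R) hinvp)).muTorsionPull φ (ofBiKummerData h toB Q odd_l R ιX hopen (strvOfBiKummerData h R) K' constEmb constEmb_injective (hdivc_of_pull_invariant h.isDivisorial R (strvOfBiKummerData h R) (baseMap_strvOfBiKummerData h R) hinvc) (hdivp_of_pull_invariant h.isDivisorial R ιX (strvOfBiKummerData h R) (baseMap_strvOfBiKummerData h R) hinvp)).N u : Aut A) = ((ofBiKummerData h toB Q odd_l R ιX hopen (strvOfBiKummerData h R) K' constEmb constEmb_injective (hdivc_of_pull_invariant h.isDivisorial R (strvOfBiKummerData h R) (baseMap_strvOfBiKummerData h R) hinvc) (hdivp_of_pull_invariant h.isDivisorial R ιX (strvOfBiKummerData h R) (baseMap_strvOfBiKummerData h R) hinvp)).muTorsionPull (Ψ.functor.map φ) (ofBiKummerData h toB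 Q odd_l R ιX hopen (strvOfBiKummerData h R) K' constEmb constEmb_injective (hdivc_of_pull_invariant h.isDivisorial R (strvOfBiKummerData h R) (baseMap_strvOfBiKummerData h R) hinvc) (hdivp_of_pull_invariant h.isDivisorial R ιX (strvOfBiKummerData h R) (baseMap_strvOfBiKummerData h R) hinvp)).N ⟨_, hu⟩ : Aut (Ψ.functor.obj A)))
    -- the NORMALISED Thm 5.7 transport (D_c = 1, e = 1: abc-iut-L2-d4 T1 + abc-iut-w5-d245 `capCupTransport_normalise`)
    (α : Ψ.functor.obj (ofBiKummerData h toB Q odd_l R ιX hopen (strvOfBiKummerData h R) K' constEmb constEmb_injective (hdivc_of_pull_invariant h.isDivisorial R (strvOfBiKummerData h R) (baseMap_strvOfBiKummerData h R) hinvc) (hdivp_of_pull_invariant h.isDivisorial R ιX (strvOfBiKummerData h R) (baseMap_strvOfBiKummerData h R) hinvp)).AN ≅ (ofBiKummerData h toB Q odd_l R ιX hopen (strvOfBiKummerData h R) K' constEmb constEmb_injective (hdivc_of_pull_invariant h.isDivisorial R (strvOfBiKummerData h R) (baseMap_strvOfBiKummerData h R) hinvc) (hdivp_of_pull_invariant h.isDivisorial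 R ιX (strvOfBiKummerData h R) (baseMap_strvOfBiKummerData h R) hinvp)).AN) (β : Ψ.functor.obj (ofBiKummerData h toB Q odd_l R ιX hopen (strvOfBiKummerData h R) K' constEmb constEmb_injective (hdivc_of_pull_invariant h.isDivisorial R (strvOfBiKummerData h R) (baseMap_strvOfBiKummerData h R) hinvc) (hdivp_of_pull_invariant h.isDivisorial R ιX (strvOfBiKummerData h R) (baseMap_strvOfBiKummerData h R) hinvp)).BN ≅ (ofBiKummerData h toB Q odd_l R ιX hopen (strvOfBiKummerData h R) K' constEmb constEmb_injective (hdivc_of_pull_invariant h.isDivisorial R (strvOfBiKummerData h R) (baseMap_strvOfBiKummerData h R) hinvc) (hdivp_of_pull_invariant h.isDivisorial R ιX (strvOfBiKummerData h R) (baseMap_strvOfBiKummerData h R) hinvp)).BN) {Dp₀ : Aut (ofBiKummerData h toB Q odd_l R ιX hopen (strvOfBiKummerData h R) K' constEmb constEmb_injective (hdivc_of_pull_invariant h.isDivisorial R (strvOfBiKummerData h R) (baseMap_strvOfBiKummerData h R) hinvc) (hdivp_of_pull_invariant h.isDivisorial R ιX (strvOfBiKummerData h R) (baseMap_strvOfBiKummerData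 h R) hinvp)).BN}
    (hc₁ : α.inv ≫ Ψ.functor.map (ofBiKummerData h toB Q odd_l R ιX hopen (strvOfBiKummerData h R) K' constEmb constEmb_injective (hdivc_of_pull_invariant h.isDivisorial R (strvOfBiKummerData h R) (baseMap_strvOfBiKummerData h R) hinvc) (hdivp_of_pull_invariant h.isDivisorial R ιX (strvOfBiKummerData h R) (baseMap_strvOfBiKummerData h R) hinvp)).sCap ≫ β.hom = (ofBiKummerData h toB Q odd_l R ιX hopen (strvOfBiKummerData h R) K' constEmb constEmb_injective (hdivc_of_pull_invariant h.isDivisorial R (strvOfBiKummerData h R) (baseMap_strvOfBiKummerData h R) hinvc) (hdivp_of_pull_invariant h.isDivisorial R ιX (strvOfBiKummerData h R) (baseMap_strvOfBiKummerData h R) hinvp)).sCap)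
    (hp₁ : α.inv ≫ Ψ.functor.map (ofBiKummerData h toB Q odd_l R ιX hopen (strvOfBiKummerData h R) K' constEmb constEmb_injective (hdivc_of_pull_invariant h.isDivisorial R (strvOfBiKummerData h R) (baseMap_strvOfBiKummerData h R) hinvc) (hdivp_of_pull_invariant h.isDivisorial R ιX (strvOfBiKummerData h R) (baseMap_strvOfBiKummerData h R) hinvp)).sCup ≫ β.hom = (ofBiKummerData h toB Q odd_l R ιX hopen (strvOfBiKummerData h R) K' constEmb constEmb_injective (hdivc_of_pull_invariant h.isDivisorial R (strvOfBiKummerData h R) (baseMap_strvOfBiKummerData h R) hinvc) (hdivp_of_pull_invariant h.isDivisorial R ιX (strvOfBiKummerData h R) (baseMap_strvOfBiKummerData h R) hinvp)).sCup ≫ Dp₀.hom) (hDp₀ : Dp₀ ∈ (ofBiKummerData h toB Q odd_l R ιX hopen (strvOfBiKummerData h R) K' constEmb constEmb_injective (hdivc_of_pull_invariant h.isDivisorial R (strvOfBiKummerData h R) (baseMap_strvOfBiKummerData h R) hinvc) (hdivp_of_pull_invariant h.isDivisorial R ιX (strvOfBiKummerData h R) (baseMap_strvOfBiKummerData h R)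 hinvp)).units (ofBiKummerData h toB Q odd_l R ιX hopen (strvOfBiKummerData h R) K' constEmb constEmb_injective (hdivc_of_pull_invariant h.isDivisorial R (strvOfBiKummerData h R) (baseMap_strvOfBiKummerData h R) hinvc) (hdivp_of_pull_invariant h.isDivisorial R ιX (strvOfBiKummerData h R) (baseMap_strvOfBiKummerData h R) hinvp)).BN)
    -- ([FrdI] Prop 5.6 pair at A_N: PRODUCED below for the constructed section — no binder)
    -- the MODEL HYPOTHESES of [FrdI] Thm 3.4 (iii)/(v) at the §4 tempered Frobenioid ([EtTh] Thm 3.7 (i)(ii))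
    (hD : IsOfFSMType D) (hslim : IsSlim D) (hnd : IsNonDilatingOn S.tf.divisorMonoid)
    (hN : ∃ A : S.C, ¬ (PreFrobenioidData.ofModel S.tf.divisorMonoid S.tf.ratFnFunctor S.tf.divBNatTrans).IsGroupLikeObj A)
    -- Prop 2.4 / T56-L02 / T56-L09c for the Galois shadow of the PRODUCED base shadow of `Ψ` through `α`
    (hΓ : ∀ θA : Aut R.AN.base ≃* Aut R.AN.base,
      (∀ f : Aut R.AN, (PreFrobenioid.baseFunctor S.F).mapIso (α.symm ≪≫ Ψ.functor.mapIso f ≪≫ α) =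
        θA ((PreFrobenioid.baseFunctor S.F).mapIso f)) →
      ∃ γ : RD.PiX ≃ₜ* RD.PiX,
        (∀ y : RD.PiX, (((ofBiKummerData h toB Q odd_l R ιX hopen (strvOfBiKummerData h R) K' constEmb constEmb_injective (hdivc_of_pull_invariant h.isDivisorial R (strvOfBiKummerData h R) (baseMap_strvOfBiKummerData h R) hinvc) (hdivp_of_pull_invariant h.isDivisorial R ιX (strvOfBiKummerData h R) (baseMap_strvOfBiKummerData h R) hinvp)).autBaseIsoAB.symm.trans θA).trans (ofBiKummerData h toB Q odd_l R ιX hopen (strvOfBiKummerData h R) K' constEmb constEmb_injective (hdivc_of_pull_invariant h.isDivisorial R (strvOfBiKummerData h R) (baseMap_strvOfBiKummerData h R) hinvc) (hdivp_of_pull_invariant h.isDivisorial R ιX (strvOfBiKummerData h R) (baseMap_strvOfBiKummerData h R) hinvp)).autBaseIsoAB) (rhoOfBiKummerData R ιX y) =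
          rhoOfBiKummerData R ιX (γ y)) ∧
        RD.PiYdd.map γ.toMulEquiv.toMonoidHom = RD.PiYdd ∧
        RD.lDeltaTheta.map γ.toMulEquiv.toMonoidHom = RD.lDeltaTheta ∧
        ∀ (k : RD.PiYdd) (hk : (k : RD.PiX) ∈ RD.lDeltaTheta) (hk' : γ k ∈ RD.lDeltaTheta),
          (ofBiKummerData h toB Q odd_l R ιX hopen (strvOfBiKummerData h R) K' constEmb constEmb_injective (hdivc_of_pull_invariant h.isDivisorial R (strvOfBiKummerData h R) (baseMap_strvOfBiKummerData h R) hinvc) (hdivp_of_pull_invariant h.isDivisorial R ιX (strvOfBiKummerData h R) (baseMap_strvOfBiKummerData h R) hinvp)).lDeltaModNMap β.hom (aΨ _ (e (RD.thetaMod ⟨k, hk⟩))) = e (RD.thetaMod ⟨γ k, hk'⟩)) :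
    ∃ ρ : RigidityFamily (ofBiKummerData h toB Q odd_l R ιX hopen (strvOfBiKummerData h R) K' constEmb constEmb_injective (hdivc_of_pull_invariant h.isDivisorial R (strvOfBiKummerData h R) (baseMap_strvOfBiKummerData h R) hinvc) (hdivp_of_pull_invariant h.isDivisorial R ιX (strvOfBiKummerData h R) (baseMap_strvOfBiKummerData h R) hinvp)), IsKummerDetermined (ofBiKummerData h toB Q odd_l R ιX hopen (strvOfBiKummerData h R) K' constEmb constEmb_injective (hdivc_of_pull_invariant h.isDivisorial R (strvOfBiKummerData h R) (baseMap_strvOfBiKummerData h R) hinvc) (hdivp_of_pull_invariant h.isDivisorial R ιX (strvOfBiKummerData h R) (baseMap_strvOfBiKummerData h R) hinvp)) P ρ hB ∧ IsFunctorialLinear (ofBiKummerData h toB Q odd_l R ιX hopen (strvOfBiKummerData h R) K' constEmb constEmb_injective (hdivc_of_pull_invariant h.isDivisorial R (strvOfBiKummerData h R) (baseMap_strvOfBiKummerData h R) hinvc) (hdivp_of_pull_invariant h.isDivisorial R ιX (strvOfBiKummerData h R) (baseMap_strvOfBiKummerData h R) hinvp)) ρ ∧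
      (∀ ρ' : RigidityFamily (ofBiKummerData h toB Q odd_l R ιX hopen (strvOfBiKummerData h R) K' constEmb constEmb_injective (hdivc_of_pull_invariant h.isDivisorial R (strvOfBiKummerData h R) (baseMap_strvOfBiKummerData h R) hinvc) (hdivp_of_pull_invariant h.isDivisorial R ιX (strvOfBiKummerData h R) (baseMap_strvOfBiKummerData h R) hinvp)), IsKummerDetermined (ofBiKummerData h toB Q odd_l R ιX hopen (strvOfBiKummerData h R) K' constEmb constEmb_injective (hdivc_of_pull_invariant h.isDivisorial R (strvOfBiKummerData h R) (baseMap_strvOfBiKummerData h R) hinvc) (hdivp_of_pull_invariant h.isDivisorial R ιX (strvOfBiKummerData h R) (baseMap_strvOfBiKummerData h R) hinvp)) P ρ' hB → IsFunctorialLinear (ofBiKummerData h toB Q odd_l R ιX hopen (strvOfBiKummerData h R) K' constEmb constEmb_injective (hdivc_of_pull_invariant h.isDivisorial R (strvOfBiKummerData h R) (baseMap_strvOfBiKummerData h R) hinvc) (hdivp_of_pull_invariant h.isDivisorial R ιX (strvOfBiKummerData h R) (baseMap_strvOfBiKummerData h R) hinvp)) ρ' → ρ' = ρ) ∧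
      CyclotomicRigidityPreserved (ofBiKummerData h toB Q odd_l R ιX hopen (strvOfBiKummerData h R) K' constEmb constEmb_injective (hdivc_of_pull_invariant h.isDivisorial R (strvOfBiKummerData h R) (baseMap_strvOfBiKummerData h R) hinvc) (hdivp_of_pull_invariant h.isDivisorial R ιX (strvOfBiKummerData h R) (baseMap_strvOfBiKummerData h R) hinvp)) Ψ ρ aΨ := by
  -- the section pair of the constructed `s^trv_N` ([FrdI] Prop 5.6, this file)
  obtain ⟨φ, hφ, hc⟩ := exists_sectionPair_strvOfBiKummerData h R
  have hKR := hKR_ofBiKummerData_of_pin h toB Q odd_l R ιX hopen (strvOfBiKummerData h R) K' constEmb constEmb_injective (hdivc_of_pull_invariant h.isDivisorial R (strvOfBiKummerData h R) (baseMap_strvOfBiKummerData h R) hinvc) (hdivp_of_pull_invariant h.isDivisorial R ιX (strvOfBiKummerData h R) (baseMap_strvOfBiKummerData h R) hinvp) (baseMap_strvOfBiKummerData h R) hfrac P H m hχX hη₀ hdies e ν hme hKν hcovHB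
  obtain ⟨θA, ΨN, hθ, hdeg, hbi, hft⟩ := exists_psiTransportData_ofBiKummerData h R hD hslim hnd hN Ψ α
  obtain ⟨γ, hγ, hP24, hγL, haΨ⟩ := hΓ θA hθ
  exact exists_rigidityFamily_unique_preserved_ofBiKummerData_of_leaves h toB Q odd_l R ιX hopen (strvOfBiKummerData h R) K' constEmb constEmb_injective (hdivc_of_pull_invariant h.isDivisorial R (strvOfBiKummerData h R) (baseMap_strvOfBiKummerData h R) hinvc) (hdivp_of_pull_invariant h.isDivisorial R ιX (strvOfBiKummerData h R) (baseMap_strvOfBiKummerData h R) hinvp) hB P hη₀ hdies e he hpre hP hcov' ν hKν (baseMap_strvOfBiKummerData h R) hgeom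
    hP34 hΔcnst hreach hLc hLi hGalT hproj hKR hH hfrac haut Ψ Ψbs eΨ aΨ hlin haΨn hpull α β hc₁ hp₁ hDp₀ φ hφ hc θA hθ ΨN hdeg
    hbi hft γ hγ hP24 hγL haΨ

end Data

end ThetaFrobenioid

end Literature.AnabelianGeometry.EtaleTheta

end
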